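import Summits.FinalStateConjecture.FinalStateConjecture.Theorems.EIHFluxBalanceInertialRecessionStubSlavingHelpers
import Summits.FinalStateConjecture.FinalStateConjecture.Theorems.EIHFluxBalanceInertialRecessionStubPseudotensorBoundMatrix

/-!
# Route EIHFluxBalance — `InertialRecession`, line `sublinear-is-free-clean-window-charges`:
# coercivity of the (boosted) Kerr–Schild form, for the slaving stub `stub_slaving`

Helper file for the crux `stmt-FinalStateConjecture-10166`
(`Summit.FinalStateConjecture.FinalStateConjecture.Theses.EIHFluxBalance.InertialRecession`),
stub `stub_slaving`. Reading the vacuum equations `Ric(Φ^*g) = 0` in the lab chart of the crux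
hypothesis (`ricAt_deviationExtend_add_bilin_eq_zero`, file `…StubSlavingHelpers`) needs the chart
map to be an IMMERSION, which follows from `C⁰`-smallness of the deviation `Φ^*g − g₀` once the
reference field `g₀` is quantitatively nondegenerate (file `…StubSlavingImmersion`). This file
supplies the quantitative nondegeneracy of each painted summand:

* `norm_le_mul_norm_kerr_bilin` — `‖v‖ ≤ (1 + 4|H(x)|) ‖g_{M,a}(x)(v, ·)‖` wherever `r > 0`
  (Euclidean operator norm of the covector `g(v,·)`; `g = η + 2Hℓ⊗ℓ`, `ℓ` null);
* `abs_scalarH_le` — `|H| ≤ |M|/r`;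
* `norm_le_mul_norm_boostedKerrBilin` — the boosted form: `‖v‖ ≤ ‖Λ‖²(1 + 4|H(y)|)‖G(x)(v,·)‖`,
  `y = Λ⁻¹(x − c)` (`‖Λ‖ ≤ 1 + 3|(Λe₀)⁰|`, `norm_lorentz_le`);
* `norm_le_const_mul_norm_boostedKerrBilin` — uniform version on a hole-following shell
  (`|(Λe₀)⁰| ≤ γ`, `r ≥ r₀ > 0`): constant `(1 + 3γ)²(1 + 4|M|/r₀)`;
* `norm_le_norm_minkowski_bilin` — `η` is `1`-coercive; `coercive_add_of_norm_le` — coercivity is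
  stable under perturbations of the form;

The consequence for the crux NEAR THE HOLES (the lab chart is an immersion on hole-following tubes at
late times, and `Ric = 0` there) is the companion file `…StubSlavingImmersion`.

Ingredients: nullity in components (`Σ_μ ℓ_μ² = 2`), Cauchy–Schwarz (`|ℓ(w)| ≤ √2‖w‖`,
`‖ℓ♯‖ = √2`) and the Euclidean time flip `w ↦ w − 2w⁰e₀` (`PseudotensorBound.reflect_apply`,
`PseudotensorBound.norm_reflect` of `…StubPseudotensorBoundMatrix`), which turns `η` into the
Euclidean pairing (`minkowski_timeFlip`). Kerr–Schild 1965, §2; O'Neill 1983, Ch. 9.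
-/

set_option linter.dupNamespace false
set_option maxSynthPendingDepth 3

noncomputable section

open scoped Topology Manifold ContDiff
open Filter Set Function TopologicalSpace Literature.Geometry.Lorentzian
  Summit.FinalStateConjecture.FinalStateConjecture.Theorems

namespace Summit.FinalStateConjecture.FinalStateConjecture.Theorems.SublinearIsFree.Slaving

/-! ### Coercivity of the Kerr–Schild form: the lab chart is an immersion at late times -/

/-- Nullity of `ℓ` in components: `ℓ₀² + ℓ₁² + ℓ₂² + ℓ₃² = 2` (`ℓ₀ = 1` and
`−ℓ₀² + Σᵢ ℓᵢ² = ℓ(ℓ♯) = 0`) wherever `r > 0` (Kerr–Schild 1965, §2; Visser arXiv:0706.0622,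
(35)). [folklore] -/
theorem sum_sq_nullCovectorFun {a : ℝ} {x : E4} (hx : 0 < Kerr.radius a x) :
    ∑ μ : Fin 4, Kerr.nullCovectorFun a x μ ^ 2 = 2 := by
  have h := Kerr.nullCovector_nullVector hx
  rw [Kerr.nullCovector, E4.covector_apply, Fin.sum_univ_four] at h
  simp only [Kerr.nullVector, PiLp.toLp_apply, Fin.isValue, if_true, one_ne_zero, if_false,
    Fin.reduceEq] at h
  have h0 : Kerr.nullCovectorFun a x 0 = 1 := rfl
  rw [Fin.sum_univ_four, h0]
  rw [h0] at h
  linear_combination h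

/-- **`|ℓ(w)| ≤ √2 ‖w‖`** (Cauchy–Schwarz with `Σ_μ ℓ_μ² = 2`). [folklore] -/
theorem abs_nullCovector_apply_le {a : ℝ} {x : E4} (hx : 0 < Kerr.radius a x) (w : E4) :
    |Kerr.nullCovector a x w| ≤ √2 * ‖w‖ := by
  have hw : √(∑ μ : Fin 4, w μ ^ 2) = ‖w‖ := by
    rw [← EuclideanSpace.real_norm_sq_eq, Real.sqrt_sq (norm_nonneg _)]
  have key : ∀ c : Fin 4 → ℝ, ∑ μ, c μ ^ 2 = 2 → ∑ μ, c μ * w μ ≤ √2 * ‖w‖ := by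
    intro c hc
    have h := Real.sum_mul_le_sqrt_mul_sqrt Finset.univ c (fun μ ↦ w μ)
    rwa [hc, hw] at h
  rw [Kerr.nullCovector, E4.covector_apply, abs_le]
  refine ⟨?_, key _ (sum_sq_nullCovectorFun hx)⟩
  have h2 := key (fun μ ↦ -Kerr.nullCovectorFun a x μ)
    (by simpa only [neg_sq] using sum_sq_nullCovectorFun hx)
  simp only [neg_mul, Finset.sum_neg_distrib] at h2
  linarith

/-- **`‖ℓ♯‖ = √2`** for the Euclidean norm of the `η`-dual null vector. [folklore] -/
theorem norm_nullVector {a : ℝ} {x : E4} (hx : 0 < Kerr.radius a x) :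
    ‖Kerr.nullVector a x‖ = √2 := by
  rw [← Real.sqrt_sq (norm_nonneg (Kerr.nullVector a x)), EuclideanSpace.real_norm_sq_eq]
  congr 1
  rw [← sum_sq_nullCovectorFun hx]
  refine Finset.sum_congr rfl fun μ _ ↦ ?_
  simp only [Kerr.nullVector, PiLp.toLp_apply]
  split_ifs <;> ring

/-- **The time flip turns `η` into the Euclidean pairing**: `η(v, w − 2w⁰e₀) = Σ_μ v^μ w^μ`.
[folklore] -/
theorem minkowski_timeFlip (v w : E4) :
    Minkowski.bilin v (w - (2 * w 0) • E4.basisVector 0) = ∑ μ : Fin 4, v μ * w μ := by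
  rw [Minkowski.bilin_apply, Fin.sum_univ_four, Fin.sum_univ_three]
  simp only [PseudotensorBound.reflect_apply, Fin.isValue, if_true, one_ne_zero, if_false, Fin.reduceEq,
    show (0 : Fin 3).succ = (1 : Fin 4) from rfl, show (1 : Fin 3).succ = (2 : Fin 4) from rfl,
    show (2 : Fin 3).succ = (3 : Fin 4) from rfl]
  ring

/-- `ℓ(w − 2w⁰e₀) = Σ_μ ℓ♯^μ w^μ` (the flip exchanges `ℓ` and its `η`-dual). [folklore] -/
theorem nullCovector_timeFlip (a : ℝ) (x w : E4) :
    Kerr.nullCovector a x (w - (2 * w 0) • E4.basisVector 0) =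
      ∑ μ : Fin 4, Kerr.nullVector a x μ * w μ := by
  rw [← Kerr.bilin_nullVector, minkowski_timeFlip]

/-- **Coercivity of the Kerr–Schild form**: wherever `r > 0`,
`‖v‖ ≤ (1 + 4|H(x)|) ‖g_{M,a}(x)(v, ·)‖` for every `v ∈ E4` (operator norm of the covector
`g(v, ·)` for the Euclidean norm of the chart). Proof: with `z = v + 2Hℓ(v)ℓ♯` one has
`g(v, w − 2w⁰e₀) = Σ z^μ w^μ`, so `‖g(v,·)‖ ≥ ‖z‖`; and `v = z − 2Hℓ(z)ℓ♯` (`ℓ(ℓ♯) = 0`) with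
`|ℓ(z)| ≤ √2‖z‖`, `‖ℓ♯‖ = √2`. (Quantitative form of `Kerr.bilin_nondegenerate`, Kerr–Schild
1965, §2.) [folklore] -/
theorem norm_le_mul_norm_kerr_bilin (M a : ℝ) {x : E4} (hx : 0 < Kerr.radius a x) (v : E4) :
    ‖v‖ ≤ (1 + 4 * |Kerr.scalarH M a x|) * ‖Kerr.bilin M a x v‖ := by
  set H := Kerr.scalarH M a x with hH
  set z : E4 := v + (2 * H * Kerr.nullCovector a x v) • Kerr.nullVector a x with hz
  -- `g(v, flip w) = Σ z^μ w^μ`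
  have hpair : ∀ w : E4, Kerr.bilin M a x v (w - (2 * w 0) • E4.basisVector 0) =
      ∑ μ : Fin 4, z μ * w μ := by
    intro w
    rw [Kerr.bilin_apply, minkowski_timeFlip, nullCovector_timeFlip, hz, ← hH]
    simp only [Finset.mul_sum, ← Finset.sum_add_distrib, PiLp.add_apply, PiLp.smul_apply,
      smul_eq_mul]
    refine Finset.sum_congr rfl fun μ _ ↦ ?_
    ring
  -- hence `‖z‖ ≤ ‖g(v,·)‖`
  have hz_le : ‖z‖ ≤ ‖Kerr.bilin M a x v‖ := by
    have h1 := (Kerr.bilin M a x v).le_opNorm (z - (2 * z 0) • E4.basisVector 0)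
    rw [hpair z, PseudotensorBound.norm_reflect, Real.norm_eq_abs] at h1
    have h2 : ‖z‖ ^ 2 ≤ ‖Kerr.bilin M a x v‖ * ‖z‖ := by
      calc ‖z‖ ^ 2 = ∑ μ : Fin 4, z μ * z μ := by
            rw [EuclideanSpace.real_norm_sq_eq]; exact Finset.sum_congr rfl fun μ _ ↦ sq (z μ)
        _ ≤ |∑ μ : Fin 4, z μ * z μ| := le_abs_self _
        _ ≤ ‖Kerr.bilin M a x v‖ * ‖z‖ := h1
    by_cases hz0 : ‖z‖ = 0
    · rw [hz0]; exact norm_nonneg _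
    · have hzpos : 0 < ‖z‖ := lt_of_le_of_ne (norm_nonneg _) (Ne.symm hz0)
      exact le_of_mul_le_mul_right (by nlinarith [h2]) hzpos
  -- and `v = z − 2Hℓ(z)ℓ♯`
  have hlz : Kerr.nullCovector a x z = Kerr.nullCovector a x v := by
    rw [hz, map_add, map_smul, Kerr.nullCovector_nullVector hx, smul_eq_mul, mul_zero, add_zero]
  have hv : v = z - (2 * H * Kerr.nullCovector a x z) • Kerr.nullVector a x := by
    rw [hlz, hz, add_sub_cancel_right]
  have hvn : ‖v‖ ≤ ‖z‖ + 2 * |H| * (√2 * ‖z‖) * √2 := by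
    calc ‖v‖ = ‖z - (2 * H * Kerr.nullCovector a x z) • Kerr.nullVector a x‖ := by rw [← hv]
      _ ≤ ‖z‖ + ‖(2 * H * Kerr.nullCovector a x z) • Kerr.nullVector a x‖ := norm_sub_le _ _
      _ = ‖z‖ + 2 * |H| * |Kerr.nullCovector a x z| * √2 := by
          rw [norm_smul, norm_nullVector hx, Real.norm_eq_abs, abs_mul, abs_mul, abs_two]
      _ ≤ ‖z‖ + 2 * |H| * (√2 * ‖z‖) * √2 := by
          gcongr
          exact abs_nullCovector_apply_le hx z
  have hs : √2 * √2 = 2 := Real.mul_self_sqrt (by norm_num)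
  calc ‖v‖ ≤ ‖z‖ + 2 * |H| * (√2 * ‖z‖) * √2 := hvn
    _ = (1 + 4 * |H|) * ‖z‖ := by linear_combination (2 * |H| * ‖z‖) * hs
    _ ≤ (1 + 4 * |H|) * ‖Kerr.bilin M a x v‖ := by gcongr

/-- `|H| ≤ |M| / r` wherever `r > 0` (`H = M r³/(r⁴ + a²z²)`; Visser arXiv:0706.0622, (33)).
[folklore] -/
theorem abs_scalarH_le (M a : ℝ) {x : E4} (hx : 0 < Kerr.radius a x) :
    |Kerr.scalarH M a x| ≤ |M| / Kerr.radius a x := by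
  unfold Kerr.scalarH
  set r := Kerr.radius a x
  have hden : 0 < r ^ 4 + a ^ 2 * x 3 ^ 2 := by positivity
  rw [abs_div, abs_mul, abs_of_pos hden, abs_of_pos (pow_pos hx 3), div_le_div_iff₀ hden hx]
  have h4 : r ^ 3 * r = r ^ 4 := by ring
  nlinarith [abs_nonneg M, mul_nonneg (abs_nonneg M) (mul_nonneg (sq_nonneg a) (sq_nonneg (x 3)))]

/-- **Coercivity of the painted (boosted) Kerr–Schild field**: for `Λ ∈ O(1,3)` and a lab point
`x` whose rest-frame position `y = Λ⁻¹(x − c)` has `r(y) > 0`,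
`‖v‖ ≤ ‖Λ‖² (1 + 4|H(y)|) ‖boostedKerrBilin Λ c M a x (v, ·)‖` (`‖Λ‖` the Euclidean operator
norm, `≤ 1 + 3|(Λe₀)⁰|` by `norm_lorentz_le`). With `injective_mfderiv_of_norm_deviation_lt`
this makes the lab chart of the crux hypothesis an immersion near each hole at late times.
[folklore] -/
theorem norm_le_mul_norm_boostedKerrBilin (Λ : lorentzGroup) (c : E4) (M a : ℝ) {x : E4}
    (hx : 0 < Kerr.radius a (poincareInv Λ c x)) (v : E4) :
    ‖v‖ ≤ ‖((Λ : E4 ≃L[ℝ] E4) : E4 →L[ℝ] E4)‖ ^ 2 * (1 + 4 * |Kerr.scalarH M a (poincareInv Λ c x)|) *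
      ‖boostedKerrBilin Λ c M a x v‖ := by
  set L : E4 →L[ℝ] E4 := ((Λ : E4 ≃L[ℝ] E4) : E4 →L[ℝ] E4) with hL
  set Li : E4 →L[ℝ] E4 := ((Λ : E4 ≃L[ℝ] E4).symm : E4 →L[ℝ] E4) with hLi
  set y := poincareInv Λ c x with hy
  set K : ℝ := 1 + 4 * |Kerr.scalarH M a y| with hK
  have hK0 : 0 ≤ K := by positivity
  -- the covector `g(Λ⁻¹v, ·)` is `boostedKerrBilin x v` precomposed with `Λ`
  have hcomp : Kerr.bilin M a y (Li v) = (boostedKerrBilin Λ c M a x v).comp L := by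
    ext w
    rw [ContinuousLinearMap.comp_apply, boostedKerrBilin_apply, ← hy, hL, hLi,
      ContinuousLinearEquiv.coe_coe, ContinuousLinearEquiv.coe_coe,
      ContinuousLinearEquiv.symm_apply_apply]
  have h1 : ‖Li v‖ ≤ K * (‖boostedKerrBilin Λ c M a x v‖ * ‖L‖) := by
    refine (norm_le_mul_norm_kerr_bilin M a hx (Li v)).trans ?_
    rw [← hK, hcomp]
    exact mul_le_mul_of_nonneg_left (ContinuousLinearMap.opNorm_comp_le _ _) hK0
  have h2 : ‖v‖ ≤ ‖L‖ * ‖Li v‖ := by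
    have h := L.le_opNorm (Li v)
    rwa [hL, hLi, ContinuousLinearEquiv.coe_coe, ContinuousLinearEquiv.coe_coe,
      ContinuousLinearEquiv.apply_symm_apply] at h
  calc ‖v‖ ≤ ‖L‖ * ‖Li v‖ := h2
    _ ≤ ‖L‖ * (K * (‖boostedKerrBilin Λ c M a x v‖ * ‖L‖)) :=
        mul_le_mul_of_nonneg_left h1 (norm_nonneg _)
    _ = ‖L‖ ^ 2 * K * ‖boostedKerrBilin Λ c M a x v‖ := by ring

/-- `‖v‖ ≤ ‖η(v, ·)‖`: the Minkowski form is `1`-coercive for the Euclidean norm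
(`η(v, v − 2v⁰e₀) = ‖v‖²`). [folklore] -/
theorem norm_le_norm_minkowski_bilin (v : E4) : ‖v‖ ≤ ‖Minkowski.bilin v‖ := by
  have h1 := (Minkowski.bilin v).le_opNorm (v - (2 * v 0) • E4.basisVector 0)
  rw [minkowski_timeFlip, PseudotensorBound.norm_reflect, Real.norm_eq_abs] at h1
  have h2 : ‖v‖ ^ 2 ≤ ‖Minkowski.bilin v‖ * ‖v‖ :=
    calc ‖v‖ ^ 2 = ∑ μ : Fin 4, v μ * v μ := by
          rw [EuclideanSpace.real_norm_sq_eq]; exact Finset.sum_congr rfl fun μ _ ↦ sq (v μ)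
      _ ≤ |∑ μ : Fin 4, v μ * v μ| := le_abs_self _
      _ ≤ ‖Minkowski.bilin v‖ * ‖v‖ := h1
  by_cases hv0 : ‖v‖ = 0
  · rw [hv0]; exact norm_nonneg _
  · exact le_of_mul_le_mul_right (by nlinarith [h2]) (lt_of_le_of_ne (norm_nonneg _) (Ne.symm hv0))

/-- **One summand of the modulated ansatz is uniformly coercive on its hole-following shell**:
with Lorentz factor `|(Λe₀)⁰| ≤ γ` and painted radius `r ≥ r₀ > 0`,
`‖v‖ ≤ (1 + 3γ)² (1 + 4|M|/r₀) ‖G(x)(v, ·)‖`. [folklore] -/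
theorem norm_le_const_mul_norm_boostedKerrBilin (Λ : lorentzGroup) (c : E4) (M a : ℝ) {γ r₀ : ℝ}
    (hγ : |((Λ : E4 ≃L[ℝ] E4) (E4.basisVector 0)) 0| ≤ γ) (hr₀ : 0 < r₀) {x : E4}
    (hx : r₀ ≤ Kerr.radius a (poincareInv Λ c x)) (v : E4) :
    ‖v‖ ≤ (1 + 3 * γ) ^ 2 * (1 + 4 * (|M| / r₀)) * ‖boostedKerrBilin Λ c M a x v‖ := by
  have hr : 0 < Kerr.radius a (poincareInv Λ c x) := hr₀.trans_le hx
  have h1 := norm_le_mul_norm_boostedKerrBilin Λ c M a hr v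
  have hL : ‖((Λ : E4 ≃L[ℝ] E4) : E4 →L[ℝ] E4)‖ ≤ 1 + 3 * γ :=
    (norm_lorentz_le Λ).trans (by linarith)
  have hH : |Kerr.scalarH M a (poincareInv Λ c x)| ≤ |M| / r₀ :=
    (abs_scalarH_le M a hr).trans (div_le_div_of_nonneg_left (abs_nonneg M) hr₀ hx)
  have hL2 : ‖((Λ : E4 ≃L[ℝ] E4) : E4 →L[ℝ] E4)‖ ^ 2 ≤ (1 + 3 * γ) ^ 2 :=
    pow_le_pow_left₀ (norm_nonneg _) hL 2
  refine h1.trans ?_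
  gcongr

/-! ### Perturbations of coercive forms -/

/-- Coercivity is stable under small perturbations of the form: if `m‖v‖ ≤ ‖G(v,·)‖` and
`‖E‖ ≤ e` then `(m − e)‖v‖ ≤ ‖(G + E)(v,·)‖`. [folklore] -/
theorem coercive_add_of_norm_le {G E : E4 →L[ℝ] E4 →L[ℝ] ℝ} {m e : ℝ}
    (hm : ∀ v : E4, m * ‖v‖ ≤ ‖G v‖) (hE : ‖E‖ ≤ e) (v : E4) :
    (m - e) * ‖v‖ ≤ ‖(G + E) v‖ := by
  have h1 : ‖E v‖ ≤ e * ‖v‖ :=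
    (E.le_opNorm v).trans (mul_le_mul_of_nonneg_right hE (norm_nonneg v))
  have h2 : ‖G v‖ ≤ ‖(G + E) v‖ + ‖E v‖ :=
    calc ‖G v‖ = ‖(G + E) v - E v‖ := by rw [add_apply, add_sub_cancel_right]
      _ ≤ ‖(G + E) v‖ + ‖E v‖ := norm_sub_le _ _
  nlinarith [hm v, h1, h2]

/-- **Registered sub-goal form** (stub `slaving_painted_summand_coercive` of the crux item) of
`norm_le_const_mul_norm_boostedKerrBilin`: one painted summand of the modulated ansatz is uniformly
coercive on its hole-following shell `{r ≥ r₀}`, with constant `(1 + 3γ)²(1 + 4|M|/r₀)`. [folklore] -/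
theorem slaving_painted_summand_coercive : open Literature.Geometry.Lorentzian in ∀ (Λ : lorentzGroup) (c : E4) (M a : ℝ) {γ r₀ : ℝ}, |((Λ : E4 ≃L[ℝ] E4) (E4.basisVector 0)) 0| ≤ γ → 0 < r₀ → ∀ {x : E4}, r₀ ≤ Kerr.radius a (poincareInv Λ c x) → ∀ (v : E4), ‖v‖ ≤ (1 + 3 * γ) ^ 2 * (1 + 4 * (|M| / r₀)) * ‖boostedKerrBilin Λ c M a x v‖ :=
  fun Λ c M a _ _ hγ hr₀ _ hx v ↦ norm_le_const_mul_norm_boostedKerrBilin Λ c M a hγ hr₀ hx v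

end Summit.FinalStateConjecture.FinalStateConjecture.Theorems.SublinearIsFree.Slaving

end
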